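import Summits.RiemannHypothesis.RiemannHypothesis.Theorems.WeilGroundStateGroundStatesConvergeToXiRenormBlowup
import Literature.NumberTheory.LFunctions.WeilGroundStateRealZerosProofs
import HarnessLib

/-!
# `WeilGroundState.GroundStatesConvergeToXi` — the renormalised overlaps converge when the
constants are bounded (crux item stmt-RiemannHypothesis-1527, route route-RiemannHypothesis-WeilGroundState;
line `Sketch`, lead c5; `--supports`; preliminaries for `…MinimalRenorm.lean`)

RH-free.  For ground states `u_k` at windows `a_k → ∞` and scalars `c_k` with `c_k û_k → ξ` locally
uniformly on the open strip and `‖c_k‖ ≤ M` eventually, the renormalised overlaps with the window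
kernels converge: `c_k ⟨u_k, φ_{a_k}⟩ → ‖Φ‖₂²` (`tendsto_renorm_overlap_of_norm_le`) — the
two-sided version of the core estimate `exists_eventually_norm_overlap_ge` of
`…RenormBlowupOverlap` (Parseval splitting on the critical line, bulk on a frequency window where
`c_k 𝓕u_k → Ξ` uniformly, tail by AM–GM with `∫|𝓕u_k|² = 1`).  Plus two bookkeeping lemmas
(`exists_nat_setIntegral_compl_Icc_le`, `mul_tail_le_of_params`).  No new definitions.
-/

noncomputable section

set_option linter.dupNamespace false

open scoped Topology Real ComplexConjugate FourierTransform
open Filter Set MeasureTheory Complex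

namespace Summit.RiemannHypothesis.RiemannHypothesis.Theorems.GroundStatesConvergeToXi

open Literature.NumberTheory.LFunctions

/-! ## The renormalised overlaps converge when the constants are bounded -/

/-- Tails of an integrable function on `ℝ`: for `δ > 0` there is `R ∈ ℕ`, `R ≥ 1`, with
`∫_{[-R,R]ᶜ} g ≤ δ`. [folklore] -/
theorem exists_nat_setIntegral_compl_Icc_le {g : ℝ → ℝ} (hgi : Integrable g) {δ : ℝ} (hδ : 0 < δ) :
    ∃ R : ℕ, 1 ≤ R ∧ ∫ ξ in (Icc (-(R : ℝ)) R)ᶜ, g ξ ≤ δ := by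
  set J : ℝ := ∫ ξ, g ξ with hJdef
  have hcompl : ∀ n : ℕ, ∫ ξ in (Icc (-(n : ℝ)) n)ᶜ, g ξ = J - ∫ ξ in Icc (-(n : ℝ)) n, g ξ := by
    intro n
    have := integral_add_compl (measurableSet_Icc (a := -(n : ℝ)) (b := n)) hgi
    rw [hJdef]; linarith
  have htail : Tendsto (fun n : ℕ => ∫ ξ in (Icc (-(n : ℝ)) n)ᶜ, g ξ) atTop (𝓝 0) := by
    have hmono : Monotone fun n : ℕ => Icc (-(n : ℝ)) n := by
      intro m n hmn
      have h : (m : ℝ) ≤ n := by exact_mod_cast hmn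
      exact Icc_subset_Icc (by linarith) h
    have hU : (⋃ n : ℕ, Icc (-(n : ℝ)) n) = univ := by
      refine eq_univ_of_forall fun x => ?_
      obtain ⟨n, hn⟩ := exists_nat_ge |x|
      exact mem_iUnion.2 ⟨n, abs_le.1 hn⟩
    have h1 := tendsto_setIntegral_of_monotone (μ := volume) (f := g)
      (fun n : ℕ => (measurableSet_Icc : MeasurableSet (Icc (-(n : ℝ)) n))) hmono
      (by rw [hU]; exact hgi.integrableOn)
    rw [hU, setIntegral_univ] at h1
    have h2 := (tendsto_const_nhds (x := J)).sub h1
    rw [← hJdef, sub_self] at h2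
    refine h2.congr fun n => ?_
    rw [hcompl n]
  obtain ⟨R, hRtail, hR1⟩ := ((htail.eventually (ge_mem_nhds hδ)).and (eventually_ge_atTop 1)).exists
  exact ⟨R, hR1, hRtail⟩

/-- Bookkeeping for the tail estimate: with `θ = ε/(8M)`, `δ₁ ≤ ε²/(128M²)` and
`η ≤ ε²/(128M²(πD²+1))`, a quantity `T ≤ θ/2 + δ₁/θ + πD²η/θ` has `M T ≤ 3ε/16`. [folklore] -/
theorem mul_tail_le_of_params {ε M D δ₁ η T : ℝ} (hε : 0 < ε) (hM : 0 < M)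
    (hδ : δ₁ ≤ ε ^ 2 / (128 * M ^ 2)) (hη : η ≤ ε ^ 2 / (128 * M ^ 2 * (π * D ^ 2 + 1)))
    (hT : T ≤ ε / (8 * M) / 2 + δ₁ / (ε / (8 * M)) + π * D ^ 2 * η / (ε / (8 * M))) :
    M * T ≤ 3 * ε / 16 := by
  have hm1 : M * (ε / (8 * M) / 2) = ε / 16 := by field_simp; ring
  have hm2 : M * (δ₁ / (ε / (8 * M))) ≤ ε / 16 := by
    calc M * (δ₁ / (ε / (8 * M))) = 8 * M ^ 2 * δ₁ / ε := by field_simp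
      _ ≤ 8 * M ^ 2 * (ε ^ 2 / (128 * M ^ 2)) / ε := by gcongr
      _ = ε / 16 := by field_simp; ring
  have hm3 : M * (π * D ^ 2 * η / (ε / (8 * M))) ≤ ε / 16 := by
    have key : π * D ^ 2 / (π * D ^ 2 + 1) ≤ 1 :=
      div_le_one_of_le₀ (by linarith) (by positivity)
    calc M * (π * D ^ 2 * η / (ε / (8 * M))) = 8 * M ^ 2 * π * D ^ 2 * η / ε := by field_simp
      _ ≤ 8 * M ^ 2 * π * D ^ 2 * (ε ^ 2 / (128 * M ^ 2 * (π * D ^ 2 + 1))) / ε := by gcongr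
      _ = ε / 16 * (π * D ^ 2 / (π * D ^ 2 + 1)) := by field_simp; ring
      _ ≤ ε / 16 * 1 := by gcongr
      _ = ε / 16 := mul_one _
  calc M * T ≤ M * (ε / (8 * M) / 2 + δ₁ / (ε / (8 * M)) + π * D ^ 2 * η / (ε / (8 * M))) :=
        mul_le_mul_of_nonneg_left hT hM.le
    _ = M * (ε / (8 * M) / 2) + M * (δ₁ / (ε / (8 * M))) + M * (π * D ^ 2 * η / (ε / (8 * M))) := by
        ring
    _ ≤ ε / 16 + ε / 16 + ε / 16 := add_le_add_three hm1.le hm2 hm3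
    _ = 3 * ε / 16 := by ring

set_option maxHeartbeats 400000 in
/-- **`c_k ⟨u_k, φ_{a_k}⟩ → ‖Φ‖₂²` for bounded constants (RH-free).**  Let `u_k` be ground states
at windows `a_k → ∞` and `c_k` scalars with `c_k û_k → ξ` locally uniformly on the open strip and
`‖c_k‖ ≤ M`.  Then `c_k ∫ u_k conj φ_{a_k} → ∫‖Φ‖²`.  (Two-sided version of the core estimate
`exists_eventually_norm_overlap_ge` of `…RenormBlowupOverlap`: Parseval splitting, bulk on a
frequency window where `c_k𝓕u_k → Ξ` uniformly, tail by AM–GM with `∫|𝓕u_k|² = 1`.) [folklore] -/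
theorem tendsto_renorm_overlap_of_norm_le {a : ℕ → ℝ} {u : ℕ → ℝ → ℂ} {c : ℕ → ℂ}
    (ha : Tendsto a atTop atTop) (hu : ∀ k, IsWeilGroundState (a k) (u k))
    (hlim : TendstoLocallyUniformlyOn (fun k s => c k * weilMellin (u k) s) riemannXi atTop
      {s : ℂ | 0 < s.re ∧ s.re < 1}) (hM : ∃ M : ℝ, ∀ᶠ k in atTop, ‖c k‖ ≤ M) :
    Tendsto (fun k => c k * ∫ t, u k t * conj ((2 : ℂ) * LagariasMontague.Psic (2 * t) *
        ((Literature.Analysis.Calculus.cutoff (a k) t : ℝ) : ℂ))) atTop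
      (𝓝 (((∫ t : ℝ, ‖(2 : ℂ) * LagariasMontague.Psic (2 * t)‖ ^ 2 : ℝ) : ℂ))) := by
  -- adapted from `exists_eventually_norm_overlap_ge` (…RenormBlowupOverlap.lean, lead c3)
  obtain ⟨M₀, hM₀⟩ := hM
  set M : ℝ := max M₀ 1 with hMdef
  have hM1 : 1 ≤ M := le_max_right _ _
  have hM : 0 < M := lt_of_lt_of_le one_pos hM1
  have hcM : ∀ᶠ k in atTop, ‖c k‖ ≤ M := hM₀.mono fun k hk => hk.trans (le_max_left _ _)
  set φ : ℝ → ℝ → ℂ := fun A t => (2 : ℂ) * LagariasMontague.Psic (2 * t) *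
    ((Literature.Analysis.Calculus.cutoff A t : ℝ) : ℂ) with hφdef
  set g : ℝ → ℝ := fun ξ => ‖riemannXi (1 / 2 + ((2 * π * ξ : ℝ) : ℂ) * I)‖ ^ 2 with hgdef
  set η : ℝ → ℝ := fun A => Real.exp (-(π / 4 * Real.exp (2 * (A - 1)))) with hηdef
  set B₁ : ℝ := LagariasMontague.fourierDecayConst + 1 with hB₁def
  have hB₁ : 0 < B₁ := by
    have := fourierDecayConst_nonneg; rw [hB₁def]; linarith
  obtain ⟨hgi, hJ, hJpos⟩ := integral_norm_sq_riemannXi_eq_and_pos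
  set J : ℝ := ∫ ξ, g ξ with hJdef
  obtain ⟨D, hD0, hD⟩ := exists_norm_tail_fourier_overlap_le
  obtain ⟨E, hE0, hE⟩ := exists_norm_bulk_fourier_overlap_sub_le
  have hη0 : ∀ A, 0 < η A := fun A => Real.exp_pos _
  rw [← hJ, Metric.tendsto_nhds]
  intro ε hε
  -- parameters
  set θ : ℝ := ε / (8 * M) with hθdef
  have hθ0 : 0 < θ := by positivity
  set δ₁ : ℝ := min (ε / 8) (ε ^ 2 / (128 * M ^ 2)) with hδ₁def
  have hδ₁0 : 0 < δ₁ := by positivity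
  -- tails of `g`: pick `R ≥ 1` with `∫_{[-R,R]ᶜ} g ≤ δ₁`
  obtain ⟨R, hR1, hRtail⟩ := exists_nat_setIntegral_compl_Icc_le hgi hδ₁0
  have hR0 : (0 : ℝ) ≤ R := by positivity
  set S : Set ℝ := Icc (-(R : ℝ)) R with hSdef
  have hS : MeasurableSet S := measurableSet_Icc
  set ε₁ : ℝ := ε / (32 * R * B₁ * (E + 1)) with hε₁def
  have hε₁0 : 0 < ε₁ := by positivity
  set ε₂ : ℝ := min ε₁ (ε ^ 2 / (128 * M ^ 2 * (π * D ^ 2 + 1))) with hε₂def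
  have hε₂0 : 0 < ε₂ := by positivity
  have hηa : Tendsto (fun k => η (a k)) atTop (𝓝 0) := tendsto_superexp_zero.comp ha
  filter_upwards [ha.eventually (eventually_ge_atTop (1 : ℝ)),
    eventually_norm_fourier_sub_riemannXi_lt hlim R hε₁0,
    hηa.eventually (ge_mem_nhds hε₂0), hcM] with k hak hbulk hηk hcMk
  have hηk0 := hη0 (a k)
  obtain ⟨-, hP⟩ := overlap_eq_bulk_add_tail (hu k) hS
  have hT := hD (a k) hak (u k) (hu k) S hS θ hθ0
  have hBu := hE (a k) hak (u k) (hu k) (c k) R hR0 ε₁ hε₁0.le (fun ξ hξ => (hbulk ξ hξ).le)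
  set bulk : ℂ := ∫ ξ in S, 𝓕 (u k) ξ * 𝓕⁻ (φ (a k)) ξ with hbulkdef
  set tail : ℂ := ∫ ξ in Sᶜ, 𝓕 (u k) ξ * 𝓕⁻ (φ (a k)) ξ with htaildef
  have hP' : (∫ t, u k t * conj (φ (a k) t)) = bulk + tail := hP
  have hT' : ‖tail‖ ≤ θ / 2 + 1 / (2 * θ) * (2 * (∫ ξ in Sᶜ, g ξ) + 2 * π * (D * η (a k)) ^ 2) := hT
  have hBu' : ‖c k * bulk - ((∫ ξ in S, g ξ : ℝ) : ℂ)‖ ≤ 2 * R * (B₁ * (ε₁ + η (a k))) * (E + 1) := hBu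
  -- (1) the tail is small: `M ‖tail‖ ≤ 3ε/16`
  have htail_le : M * ‖tail‖ ≤ 3 * ε / 16 := by
    have h3 : (D * η (a k)) ^ 2 ≤ D ^ 2 * η (a k) := by
      have hη1 : η (a k) ≤ 1 := by
        rw [hηdef]
        exact Real.exp_le_one_iff.2 (by
          have := Real.exp_pos (2 * (a k - 1)); nlinarith [Real.pi_gt_three])
      rw [mul_pow]
      refine mul_le_mul_of_nonneg_left ?_ (by positivity)
      nlinarith
    have hRt : ∫ ξ in Sᶜ, g ξ ≤ δ₁ := hRtail
    have h4 : ‖tail‖ ≤ θ / 2 + δ₁ / θ + π * D ^ 2 * η (a k) / θ := by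
      refine hT'.trans ?_
      have hθ' : 0 ≤ 1 / (2 * θ) := by positivity
      have h5 : 2 * (∫ ξ in Sᶜ, g ξ) + 2 * π * (D * η (a k)) ^ 2 ≤
          2 * δ₁ + 2 * π * (D ^ 2 * η (a k)) := by nlinarith [Real.pi_pos]
      have h6 := mul_le_mul_of_nonneg_left h5 hθ'
      have e : 1 / (2 * θ) * (2 * δ₁ + 2 * π * (D ^ 2 * η (a k))) =
          δ₁ / θ + π * D ^ 2 * η (a k) / θ := by
        field_simp
      linarith
    exact mul_tail_le_of_params hε hM (min_le_right _ _) (hηk.trans (min_le_right _ _)) h4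
  -- (2) the bulk is close to `J_S`, and `J_S` is close to `J`
  have hbulk_le : ‖c k * bulk - ((∫ ξ in S, g ξ : ℝ) : ℂ)‖ ≤ ε / 8 := by
    have hη2 : η (a k) ≤ ε₁ := hηk.trans (min_le_left _ _)
    have h1 : 2 * R * (B₁ * (ε₁ + η (a k))) * (E + 1) ≤ 2 * R * (B₁ * (ε₁ + ε₁)) * (E + 1) := by
      gcongr
    have e : 2 * R * (B₁ * (ε₁ + ε₁)) * (E + 1) = ε / 8 := by
      rw [hε₁def]; field_simp; ring
    linarith
  have hJS : |(∫ ξ in S, g ξ) - J| ≤ ε / 8 := by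
    have h1 : ∫ ξ in (Icc (-(R : ℝ)) R)ᶜ, g ξ = J - ∫ ξ in Icc (-(R : ℝ)) R, g ξ := by
      have := integral_add_compl (measurableSet_Icc (a := -(R : ℝ)) (b := R)) hgi
      rw [hJdef]; linarith
    have h2 : ∫ ξ in Sᶜ, g ξ ≤ δ₁ := hRtail
    have h3 : 0 ≤ ∫ ξ in Sᶜ, g ξ := setIntegral_nonneg hS.compl fun _ _ => by positivity
    have h4 : δ₁ ≤ ε / 8 := min_le_left _ _
    rw [hSdef] at h2 h3 ⊢
    rw [abs_le]
    constructor <;> linarith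
  -- (3) combine
  rw [dist_eq_norm, hP', mul_add]
  have e1 : c k * bulk + c k * tail - ((J : ℝ) : ℂ) =
      (c k * bulk - ((∫ ξ in S, g ξ : ℝ) : ℂ)) + ((((∫ ξ in S, g ξ) - J : ℝ)) : ℂ) + c k * tail := by
    push_cast; ring
  rw [e1]
  have h2 : ‖c k * tail‖ ≤ M * ‖tail‖ := by
    rw [norm_mul]
    exact mul_le_mul_of_nonneg_right hcMk (norm_nonneg _)
  have h3 : ‖((((∫ ξ in S, g ξ) - J : ℝ)) : ℂ)‖ ≤ ε / 8 := by
    rw [Complex.norm_real, Real.norm_eq_abs]; exact hJS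
  calc ‖(c k * bulk - ((∫ ξ in S, g ξ : ℝ) : ℂ)) + ((((∫ ξ in S, g ξ) - J : ℝ)) : ℂ) + c k * tail‖
      ≤ ‖c k * bulk - ((∫ ξ in S, g ξ : ℝ) : ℂ)‖ + ‖((((∫ ξ in S, g ξ) - J : ℝ)) : ℂ)‖ + ‖c k * tail‖ :=
        norm_add₃_le
    _ ≤ ε / 8 + ε / 8 + 3 * ε / 16 := by linarith
    _ < ε := by linarith

end Summit.RiemannHypothesis.RiemannHypothesis.Theorems.GroundStatesConvergeToXi

end
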